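import Summits.BirchSwinnertonDyer.BirchSwinnertonDyer.Theorems.GenusKolyvaginAtTwoGenusPrimitiveSupplyAtTwoTranspositionKummerReading
import Summits.BirchSwinnertonDyer.BirchSwinnertonDyer.Theorems.GenusKolyvaginAtTwoMazurRubinProp33
import Summits.BirchSwinnertonDyer.BirchSwinnertonDyer.Theorems.ByReductionTypeAtTwoRankOneAtTwoBigImageOddLocalOneDoorBottomTranspositionCount
import HarnessLib

/-!
# Route `GenusKolyvaginAtTwo`, crux #2 `GenusPrimitiveSupplyAtTwo` (stmt-BirchSwinnertonDyer-22136):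
# the cell's T-q₀ `F1Sign2.TranspositionDoor.TranspositionTwistLawAtTwo` BY NAME, UNCONDITIONALLY
# (Mazur–Rubin 2010 Cor. 3.4 (i) at `T = {q₀}` + Kramer 1981 Prop. 3 — the transposition door at `Δ < 0`)

Width seat `bsd-line-gk2-p4` g13 (cell `bsd-f1-sign2`), sequel of `…TranspositionReduction` / `…TranspositionKummerReading` (the Kummer
reading of the door: `MeetsNonNormAt W q ↔ loc_q Sel₂(W) ≠ 0`) and of gk2-p4 g12's `…TwistMenuFrame` (§79: Mazur–Rubin Cor. 3.4 (i) with ONE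
finite `T`-place, both directions, four-row menu, unconditional). THEOREMS ONLY (no definition, no named fact, no `sorry`); helper
`--supports stmt-BirchSwinnertonDyer-22136`; no item is closed; BSD is not proved by any of this.

WHAT.
* §7 `transpAdmissible_place_menu` — for a transposition-admissible `(d, q₀)` (`F1Sign2.TranspositionDoor.TranspAdmissible W d q₀`: `d < 0`
  squarefree, `d ≡ 1 (8)`, `q₀ ∣ d` good with `(Δ/q₀) = −1`, the other primes of `d` good with `a_q` odd, `(d/ℓ) = 1` at odd bad `ℓ`) every
  finite place `v ≠ v_{q₀}` of `ℚ` is on the menu: split in `ℚ(√d)` (over `2` and the odd bad primes), or odd and silent for both curves (the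
  other primes of `d`), or odd and good for both (the rest) — gk2-p5's `descAdmissible_place_menu` with the door prime removed;
* §8 **`transpositionTwistLawAtTwo_holds : TranspositionTwistLawAtTwo`** — for `W/ℚ` globally minimal elliptic with `Δ_W < 0`, `E(ℚ)[2] = 0`,
  Mordell–Weil rank `1`, `Ш(W)[2] = 0` and `(d, q₀)` transposition-admissible: `#Sel₂(W^{(d)}) = 1` if `E(ℚ)` meets the non-norm coset at
  `q₀` (DOWN: some Selmer class is non-trivial at `q₀`), `#Sel₂(W^{(d)}) = 4` otherwise (UP: `Sel₂(W)` strict at `q₀`). At `q₀`: odd, good,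
  ramified in `ℚ(√d)` (`v(d) = 1`), `#E(ℚ_{q₀})[2] = 2` (`(Δ/q₀) = −1`, the LEAD's `natCard_ker_nsmul_adicCompletion_two_eq_two_of_jacobiSym`);
  at `∞`: `Δ < 0` so `H¹(ℝ, ·) = 0` for both curves. No hypothesis is left: Poitou–Tate, Tate χ, the Lemma 2.10/2.11 menus, the frame datum and
  Kramer's congruence for the canonical identification are tree theorems (gk2-p1/p4/p5), Hensel at `q₀` is `…TranspositionReduction`.

Honest framing: T-q₀ is IN PRINT (REF2 v16 §42: Mazur–Rubin 2010 Prop. 3.3 at `T = {q₀}` + Kramer 1981 Prop. 3, grade KNOWN; REF1 §54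
theorem-grade; census ENGINE H 1 504/1 504) and becomes a kernel theorem with no hypothesis; beyond-print theorem: no; the fkl line's leaf
`S_twistSelmer` (`Lines/egg_kolyvagin_two`) now has three of its four conjuncts in the tree (T-A, T-C by gk2-p4 g12; T-q₀ here; T-2q open);
AN-22K `TranspositionDoorLawAtTwo` stays a conjecture. No item is closed; crux 22136 stays OPEN at (U) ∧ (CONV₂); BSD is not proved by any of this.

References: [MazurRubin2010] Def. 3.1, Lemma 2.2 (i), Lemmas 2.9–2.11, Prop. 3.3, Cor. 3.4 (i); [Kramer1981] Prop. 3, Thm. 1; [SilvermanAEC2009]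
VII.2.1, X.4.2 (a); [MilneADT2006] I Thm. 2.8, 4.10.
-/

set_option linter.dupNamespace false -- tree convention: `Summit.BirchSwinnertonDyer.BirchSwinnertonDyer.Theorems` (summit = sub-problem)
set_option autoImplicit false

noncomputable section

open scoped Classical ContRepresentation

namespace Summit.BirchSwinnertonDyer.BirchSwinnertonDyer.Theorems.GenusKolyTransp

open WeierstrassCurve Field NumberField IsDedekindDomain Function
open Literature.NumberTheory.EllipticCurves Literature.NumberTheory.GaloisRepresentations
open Literature.NumberTheory.GaloisRepresentations.IsNonarchimedeanLocalField
open Literature.NumberTheory.GaloisCohomology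
open Rat.HeightOneSpectrum (primesEquiv natGenerator)
open Summit.BirchSwinnertonDyer.Rank1Residual.F1Sign2
open Summit.BirchSwinnertonDyer.Rank1Residual.F1Sign2.TranspositionDoor (TranspAdmissible MeetsNonNormAt TranspositionTwistLawAtTwo)
open Summit.BirchSwinnertonDyer.BirchSwinnertonDyer.Theorems.GenusKolyTwistLocal
open Summit.BirchSwinnertonDyer.BirchSwinnertonDyer.Theorems.GenusKolyArch
open Summit.BirchSwinnertonDyer.BirchSwinnertonDyer.Theorems.GenusKolyTwistingPrime (primesEquiv_eq natCast_not_mem_of_not_dvd)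
open Summit.BirchSwinnertonDyer.BirchSwinnertonDyer.Theorems.GenusKolyTwistRamified
  (valuation_natCast_eq_exp_neg_one_of_mem closureEmb_geomSqrt_not_mem_maxUnramified_rat)
open Summit.BirchSwinnertonDyer.BirchSwinnertonDyer.Theorems.RankOneAtTwoOneDoor (natCard_ker_nsmul_adicCompletion_two_eq_two_of_jacobiSym)

universe u

variable (W : WeierstrassCurve ℚ) [W.IsElliptic] [W.IsGloballyMinimal]

/-! ## §7 A transposition-admissible `(d, q₀)` puts every finite place `v ≠ v_{q₀}` on the menu -/

/-- **The finite place menu off the door prime.** `W/ℚ` globally minimal elliptic, `(d, q₀)` transposition-admissible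
(`F1Sign2.TranspositionDoor.TranspAdmissible W d q₀`), `v₀ ∋ q₀` the place of the door prime, `Wd = C • W^{(d)}`, `φ, ψ` inverse intertwinings
`Wd[2] ≅ W[2]`: every finite place `v ≠ v₀` of `ℚ` is split in `ℚ(√d)` (over `2`: `d ≡ 1 (8)`; over an odd bad prime: `(d/ℓ) = 1`), or odd and
silent for both curves (over the primes `q ≠ q₀` of `d`: `a_q` odd), or odd and good for both.
[cite: Serre1973, Ch. II §3.3 Thm 3] [cite: Serre1973, Ch. II §3.3 Thm 4] [cite: Kramer1981, Prop. 3] [cite: MazurRubin2010, Lemma 2.10] -/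
theorem transpAdmissible_place_menu {d : ℤ} {q₀ : ℕ} (hd : TranspAdmissible W d q₀)
    {v₀ : HeightOneSpectrum (𝓞 ℚ)} (hv₀ : (q₀ : 𝓞 ℚ) ∈ v₀.asIdeal) {Wd : WeierstrassCurve ℚ} [Wd.IsElliptic]
    {C : VariableChange ℚ} (hC : C • W.quadraticTwist (d : ℚ) = Wd)
    (φ : (Wd.torsionGaloisModule ((2 : ℕ) : ℤ)).toContRepresentation →ⁱL
      (W.torsionGaloisModule ((2 : ℕ) : ℤ)).toContRepresentation)
    (ψ : (W.torsionGaloisModule ((2 : ℕ) : ℤ)).toContRepresentation →ⁱL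
      (Wd.torsionGaloisModule ((2 : ℕ) : ℤ)).toContRepresentation)
    (hψφ : ∀ a, ψ (φ a) = a) (hφψ : ∀ b, φ (ψ b) = b) :
    ∀ v : HeightOneSpectrum (𝓞 ℚ), v ≠ v₀ →
      (∃ s : v.adicCompletion ℚ, s ^ 2 = algebraMap ℚ (v.adicCompletion ℚ) (d : ℚ)) ∨
      (((2 : ℕ) : 𝓞 ℚ) ∉ v.asIdeal ∧
        ¬ 2 ∣ (W.baseChange (v.adicCompletion ℚ)).localTamagawaNumber (v.adicCompletionIntegers ℚ) ∧
        ¬ 2 ∣ (Wd.baseChange (v.adicCompletion ℚ)).localTamagawaNumber (v.adicCompletionIntegers ℚ)) ∨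
      (((2 : ℕ) : 𝓞 ℚ) ∉ v.asIdeal ∧ W.HasGoodReductionAt v ∧ Wd.HasGoodReductionAt v) ∨
      (((2 : ℕ) : 𝓞 ℚ) ∉ v.asIdeal ∧
        Nat.card (nsmulAddMonoidHom 2 : (W.baseChange (v.adicCompletion ℚ)).toAffine.Point →+ _).ker = 1 ∧
        Nat.card (nsmulAddMonoidHom 2 : (Wd.baseChange (v.adicCompletion ℚ)).toAffine.Point →+ _).ker = 1) := by
  obtain ⟨-, -, hd8, hq₀, -, -, hprimes, hbad⟩ := hd
  intro v hv
  haveI := Fact.mk (primesEquiv v).2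
  have hpP : (primesEquiv v : ℕ).Prime := (primesEquiv v).2
  have hpv : ((primesEquiv v : ℕ) : 𝓞 ℚ) ∈ v.asIdeal := Rat.HeightOneSpectrum.natCast_natGenerator_mem v
  -- a `p`-adic square gives the split option
  have hsplit : IsSquare ((d : ℤ) : ℚ_[(primesEquiv v : ℕ)]) →
      ∃ s : v.adicCompletion ℚ, s ^ 2 = algebraMap ℚ (v.adicCompletion ℚ) (d : ℚ) := fun hsq ↦ by
    have hsq' : IsSquare (((d : ℚ) : ℚ) : ℚ_[(primesEquiv v : ℕ)]) := by
      simpa only [Rat.cast_intCast] using hsq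
    obtain ⟨s, hs⟩ := TwoDescentLocal.isSquare_algebraMap_adicCompletion_of_padic v hsq'
    exact ⟨s, by rw [sq]; exact hs.symm⟩
  by_cases hp2 : (primesEquiv v : ℕ) = 2
  · -- over `2`: `d ≡ 1 (mod 8)` is a `2`-adic square
    exact Or.inl (hsplit (Literature.NumberTheory.QuadraticForms.padic_isSquare_intCast_of_mod_eight hp2 hd8))
  have h2v : ((2 : ℕ) : 𝓞 ℚ) ∉ v.asIdeal :=
    GenusKolyTwistingPrime.natCast_not_mem_of_not_dvd hpP hpv fun h ↦
      hp2 ((Nat.prime_dvd_prime_iff_eq hpP Nat.prime_two).mp h)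
  by_cases hpd : ((primesEquiv v : ℕ) : ℤ) ∣ d
  · -- over a prime `p ≠ q₀` of `d`: odd, good, `a_p` odd ⟹ silent for `W`, hence for `Wd`
    obtain ⟨hgood, hodd⟩ := hprimes _ hpP hpd
    have hpq₀ : (primesEquiv v : ℕ) ≠ q₀ := by
      intro h
      apply hv
      apply primesEquiv.injective
      exact Subtype.ext (h.trans (primesEquiv_eq hq₀ hv₀).symm)
    have hodd' := hodd hpq₀
    have hgood' : W.HasGoodReductionAtPrime (primesEquiv v : ℕ) := hgood inferInstance
    have hpΔ : ¬ ((primesEquiv v : ℕ) : ℤ) ∣ minimalDiscriminantInt W :=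
      W.not_dvd_minimalDiscriminantInt_of_hasGoodReductionAtPrime' _ hgood'
    have hsil := (GenusKolyTwin.silent_iff_odd_frobeniusTrace W hp2 hpΔ).mpr hodd'
    have hker : Nat.card (nsmulAddMonoidHom 2 : (W.baseChange (v.adicCompletion ℚ)).toAffine.Point →+ _).ker = 1 := by
      rw [natCard_ker_nsmul_adicCompletion_eq_padic W v 2]
      have h0 := GenusKolyTwin.twoTorsion_padic_eq_zero_of_forall_ne W hp2 hpΔ hsil
      rw [Nat.card_eq_one_iff_unique]
      refine ⟨⟨fun a b ↦ Subtype.ext ((h0 a.1 a.2).trans (h0 b.1 b.2).symm)⟩, ⟨⟨0, by simp⟩⟩⟩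
    refine Or.inr (Or.inr (Or.inr ⟨h2v, hker, ?_⟩))
    rw [@natCard_ker_nsmul_eq_of_intertwining ℚ _ _ W Wd _ _ 2 two_ne_zero φ ψ hψφ hφψ (v.adicCompletion ℚ) _
      (HeightOneSpectrum.instAlgebraAdicCompletion (𝓞 ℚ) ℚ v) (charZero_adicCompletion v)]
    exact hker
  by_cases hpN : (primesEquiv v : ℕ) ∣ W.conductorNorm ℤ
  · -- over an odd bad prime: `(d/p) = 1` makes `d` a `p`-adic square
    have hnotgood : ∀ _h : Fact (primesEquiv v : ℕ).Prime, ¬ W.HasGoodReductionAtPrime (primesEquiv v : ℕ) := fun _ hg ↦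
      not_dvd_conductorNorm_of_hasGoodReductionAtPrime W hg hpN
    have hJ := hbad _ hpP hp2 hnotgood
    exact Or.inl (hsplit (padic_isSquare_of_jacobiSym_eq_one hp2 hJ))
  · -- over an odd good prime not dividing `d`: good for both
    have hW : W.HasGoodReductionAt v := by
      by_contra h
      exact hpN ((W.dvd_conductorNorm_iff v).mpr h)
    have hp2d : ¬ (((primesEquiv v : Nat.Primes) : ℕ) : ℤ) ∣ 2 * d := by
      intro h
      rcases (Nat.prime_iff_prime_int.mp hpP).dvd_or_dvd h with h2' | hd'
      · exact hp2 ((Nat.prime_dvd_prime_iff_eq hpP Nat.prime_two).mp (by exact_mod_cast h2'))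
      · exact hpd hd'
    exact Or.inr (Or.inr (Or.inl ⟨h2v, hW, hasGoodReductionAt_of_smul_quadraticTwist W v hp2d hW hC⟩))

/-! ## §8 T-q₀ BY NAME -/

omit W in
/-- **T-q₀ `F1Sign2.TranspositionDoor.TranspositionTwistLawAtTwo` HOLDS** (Mazur–Rubin 2010 Cor. 3.4 (i) with `K = ℚ`, `F = ℚ(√d)`,
`T = {q₀}` + Kramer 1981 Prop. 3; census ENGINE H 1 504/1 504): for every globally minimal elliptic `W/ℚ` with `Δ_W < 0`, `E(ℚ)[2] = 0`,
Mordell–Weil rank `1`, `Ш(W)[2] = 0` and every transposition-admissible `(d, q₀)`: if `E(ℚ)` meets the non-norm coset at `q₀` then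
`#Sel₂(W^{(d)}) = 1`, otherwise `#Sel₂(W^{(d)}) = 4`. DOWN/UP at the single `T`-place `v_{q₀}` (odd, good, ramified, `#E(ℚ_{q₀})[2] = 2`)
by §79 with the menu of §7 and `H¹(ℝ, ·) = 0` (`Δ < 0`); the direction is the Kummer reading of the door (§6) and `#Sel₂(W) = 2`
(`selmerTwoCard_eq_two_of_rank_one`). No hypothesis left. [cite: MazurRubin2010, Prop. 3.3 and Cor. 3.4 (i)] [cite: Kramer1981, Prop. 3 and Thm. 1]
[cite: MilneADT2006, I Thm. 2.8, 4.10] -/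
theorem transpositionTwistLawAtTwo_holds : TranspositionTwistLawAtTwo := by
  intro W _ _ _ hΔ hT hrank hSha d q₀ _ hadm
  have hd := hadm
  obtain ⟨hdneg, hsf, hd8, hq₀, hq₀d, hjac, hprimes, -⟩ := hadm
  -- the place of the door prime
  obtain ⟨v₀, hv₀⟩ : ∃ v₀ : HeightOneSpectrum (𝓞 ℚ), (q₀ : 𝓞 ℚ) ∈ v₀.asIdeal :=
    ⟨primesEquiv.symm ⟨q₀, hq₀⟩, by
      have h := Rat.HeightOneSpectrum.natCast_natGenerator_mem (primesEquiv.symm ⟨q₀, hq₀⟩)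
      rwa [show natGenerator (primesEquiv.symm ⟨q₀, hq₀⟩) = q₀ from
        congrArg Subtype.val (primesEquiv.apply_symm_apply (⟨q₀, hq₀⟩ : Nat.Primes))] at h⟩
  have hq₀2 : q₀ ≠ 2 := by
    rintro rfl
    have h2d : (2 : ℤ) ∣ d := by exact_mod_cast hq₀d
    omega
  have hn2 : ¬ q₀ ∣ 2 := fun h ↦ hq₀2 ((Nat.prime_dvd_prime_iff_eq hq₀ Nat.prime_two).mp h)
  have hgood₀ : W.HasGoodReductionAtPrime q₀ := (hprimes q₀ hq₀ hq₀d).1 inferInstance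
  have hq₀Δ : ¬ (q₀ : ℤ) ∣ minimalDiscriminantInt W := W.not_dvd_minimalDiscriminantInt_of_hasGoodReductionAtPrime' _ hgood₀
  have hq₀Δ' : ¬ (q₀ : ℤ) ∣ W.Δ.num := by rwa [← cast_minimalDiscriminantInt W, Rat.num_intCast]
  -- the `T`-place facts at `v₀`
  have h2v₀ : ((2 : ℕ) : 𝓞 ℚ) ∉ v₀.asIdeal := natCast_not_mem_of_not_dvd hq₀ hv₀ hn2
  have hv₀W : W.HasGoodReductionAt v₀ := by
    obtain hpq := primesEquiv_eq hq₀ hv₀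
    subst hpq
    exact (hasGoodReductionAtPrime_iff_hasGoodReductionAt_ringOfIntegers v₀ W).mp hgood₀
  have hram : closureEmb (K := ℚ) (v₀.adicCompletion ℚ) (geomSqrt ((d : ℤ) : ℚ)) ∉ maxUnramified (v₀.adicCompletion ℚ) := by
    apply closureEmb_geomSqrt_not_mem_maxUnramified_rat v₀
    obtain ⟨m, hm⟩ := hq₀d
    have hqm : ¬ (q₀ : ℤ) ∣ m := fun hm' ↦ by
      have hsq : (q₀ : ℤ) * q₀ ∣ d := by rw [hm]; exact mul_dvd_mul_left _ hm'
      have hu := hsf _ hsq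
      rw [Int.isUnit_iff] at hu
      rcases hu with hu | hu
      · exact hq₀.one_lt.ne' (by exact_mod_cast hu)
      · have : (0 : ℤ) ≤ (q₀ : ℤ) := by positivity
        omega
    rw [show ((d : ℤ) : ℚ) = ((q₀ : ℕ) : ℚ) * ((m : ℤ) : ℚ) by rw [hm]; push_cast; ring, Valuation.map_mul,
      valuation_natCast_eq_exp_neg_one_of_mem v₀ hq₀ hv₀, valuation_intCast_eq_one_of_not_dvd (K := ℚ) (v := v₀) hq₀ hv₀ hqm,
      mul_one]
  have ht : Nat.card (nsmulAddMonoidHom 2 : (W.baseChange (v₀.adicCompletion ℚ)).toAffine.Point →+ _).ker = 2 :=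
    natCard_ker_nsmul_adicCompletion_two_eq_two_of_jacobiSym W hq₀2 hgood₀ hq₀Δ' hjac hv₀
  -- the twist
  have hd0 : d ≠ 0 := hdneg.ne
  have hdQ : ((d : ℤ) : ℚ) ≠ 0 := by exact_mod_cast hd0
  haveI := W.isElliptic_quadraticTwist hdQ
  set Wd : WeierstrassCurve ℚ := W.quadraticTwist ((d : ℤ) : ℚ) with hWd
  have hC : (1 : VariableChange ℚ) • W.quadraticTwist ((d : ℤ) : ℚ) = Wd := one_smul _ _
  obtain ⟨φ, ψ, hψφ, hφψ, -⟩ := exists_intertwining_hsplit W hdQ hC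
  -- the menus
  have hfin := transpAdmissible_place_menu W hd hv₀ hC φ ψ hψφ hφψ
  have hinf : ∀ w : InfinitePlace ℚ,
      (∃ s : w.Completion, s ^ 2 = algebraMap ℚ w.Completion ((d : ℤ) : ℚ)) ∨
      ((∀ y : galoisCohomology (W.localGaloisModule w.Completion) 1, y = 0) ∧
        (∀ y : galoisCohomology (Wd.localGaloisModule w.Completion) 1, y = 0)) := by
    intro w
    right
    have hneg' : Wd.Δ < 0 := by
      rw [hWd, quadraticTwist_Δ]
      exact mul_neg_of_pos_of_neg (by positivity) hΔ
    exact ⟨fun y ↦ GenusExact.ArchVanishing.localH1_infinitePlace_eq_zero_of_Δ_neg W w hΔ y,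
      fun y ↦ GenusExact.ArchVanishing.localH1_infinitePlace_eq_zero_of_Δ_neg _ w hneg' y⟩
  obtain ⟨hup, hdown⟩ := natCard_selmerGroup_twist_directed_of_menu_frame W Wd hdQ hC v₀ h2v₀ hv₀W hram ht hfin hinf
  -- `#Sel₂(W) = 2` and the model
  have hSel : Nat.card (W.selmerGroup ((2 : ℕ) : ℤ)) = 2 := by
    rw [Nat.cast_ofNat]
    exact selmerTwoCard_eq_two_of_rank_one W hT hrank hSha
  have hmodel : Nat.card (Wd.selmerGroup ((2 : ℕ) : ℤ)) = twistSelmerTwoCard W d := by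
    rw [Nat.cast_ofNat]
    exact GenusKolyTwin.natCard_selmerGroup_model_eq_twistSelmerTwoCard W hd0 Wd ⟨1, hC⟩
  rw [hSel, hmodel] at hup hdown
  refine ⟨fun hmeets ↦ ?_, fun hshut ↦ ?_⟩
  · have h := hdown (exists_mem_selmerGroup_localization_ne_zero_of_meetsNonNormAt W v₀ hv₀ hq₀2 hq₀Δ hmeets)
    omega
  · have h := hup (forall_mem_selmerGroup_localization_eq_zero_of_not_meetsNonNormAt W v₀ hv₀ hq₀2 hq₀Δ hSha hshut)
    omega

end Summit.BirchSwinnertonDyer.BirchSwinnertonDyer.Theorems.GenusKolyTransp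

end
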